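import Summits.Ventures.QEC.CircuitDistance.PortFibreComplete
import HarnessLib

/-!
# P3-PORT addendum: a CERTIFICATE-CHECKED DECIDER for «leaf not realised» (venture QEC, experiment cell CDX, seat qec-cdx-type-2;
# director-qec R163 (2) option (C); generic — no circuit order, no code; nothing here asserts a value of `d_circ`)

PROBLEM. A fibre leaf `L : Fibre.Leaf` with budget `≤ 1` is REALISED (`Leaf.Realised`) iff one can pick one coordinate in each of its
`k` groups, plus at most one null coordinate, so that every detector is covered an even number of times — equivalently
(`PortFibreComplete`, `Leaf.completes_of_realised`) iff the extended groups `0 … k` have a COMPLETION to parity `∅`. The lane refuted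
this so far per leaf by an LRAT replay of a CNF (`Leaf.not_realised_of_unsat`), whose hint volume for order #345 is ≈ 200× the
`[[144]]` one. Here the refutation is a SEARCH CERTIFICATE `Cert = (order, dtab, gms)` checked in the kernel with `Nat` bit operations:

* DUALS `i = 0, 1, …`: `Y_i` = the detectors `d` with bit `i` of `dtab.get d` (a binary-tree table), `G_i` = the extended groups `g`
  with bit `i` of `gms[g]`. Dual `i` pairs with a column `c` of group `g` as `|Y_i ∩ c| + [g ∈ G_i]` (bit `i` of `Cert.dmask`, an XOR
  of table entries) and with a search state (target `T`, remaining groups `rem`) as `|Y_i ∩ T| + |G_i ∩ rem|` (mod 2). FARKAS: if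
  every column of every remaining group pairs EVENLY, so does every completion — an ODD state pairing refutes it (`Leaf.farkas`).
* `dfs` — depth-first over `order` (a permutation of the extended groups), carrying `p` = the pairings of ALL duals with the current
  state (one `Nat`, XOR-updated with the column masks) and `t` = the target bitmask; a child is PRUNED when `p` has a bit outside
  `vmask` (= the duals pairing oddly with some deeper column, i.e. the currently invalid ones); at full depth the target must be
  non-zero. **`Leaf.not_realised_of_certRefutes`**: `L.budget ≤ 1 → L.certRefutes C = true → ¬ L.Realised` — for ANY `C`.
The certificate is found outside Lean (GF(2)-relaxation DFS; each uncaught prunable child contributes one RREF dual; reference emitter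
`run/shared/lean/pub/qec/cdx/type-2/tools/fd/emit.py`); the kernel does no elimination. Measured (`decide +kernel`, whole test file):
order-#345 `X` `(9,1)` worst word (qec-cdx-crit-1's word 5: 216 class columns + 720 null columns as ONE leaf; 710 duals; DFS
41 390 nodes / 1.2·10⁶ children) 150 s; crit-1's word 4 (655 duals) 17 s; `(10,0)` word 0 (21 duals) and the all-linear `(9,1)` word
≈ 4 s each.
-/

namespace Summit.Ventures.QEC.CircuitDistance

namespace Fibre

/-! ## `Bool` parities as elements of `ZMod 2`; predicate pairings; bitmasks -/

/-- A `Bool` as an element of `ZMod 2`. -/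
def bz (b : Bool) : ZMod 2 := if b then 1 else 0

/-- `bz` is additive over `xor`. -/
theorem bz_xor (a b : Bool) : bz (xor a b) = bz a + bz b := by cases a <;> cases b <;> decide

/-- The PREDICATE PAIRING `⟨P, s⟩ = #{d ∈ s | P d} mod 2`. -/
def ppar (P : ℕ → Bool) (s : Finset ℕ) : ZMod 2 := ((s.filter fun d => P d = true).card : ZMod 2)

/-- The predicate pairing as a sum of indicators. -/
theorem ppar_eq_sum (P : ℕ → Bool) (s : Finset ℕ) : ppar P s = ∑ d ∈ s, bz (P d) := by
  unfold ppar
  rw [Finset.natCast_card_filter]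
  refine Finset.sum_congr rfl fun d _ => ?_
  simp only [bz]

/-- Inside a finite universe the predicate pairing is a set pairing. -/
theorem ppar_eq_par (P : ℕ → Bool) {s S : Finset ℕ} (h : s ⊆ S) : ppar P s = par (S.filter fun d => P d = true) s := by
  unfold ppar par
  congr 2
  ext d
  simp only [Finset.mem_filter, Finset.mem_inter]
  exact ⟨fun hd => ⟨⟨h hd.1, hd.2⟩, hd.1⟩, fun hd => ⟨hd.2, hd.1.2⟩⟩

/-- The predicate pairing is additive under symmetric difference. -/
theorem ppar_symmDiff (P : ℕ → Bool) (a b : Finset ℕ) : ppar P (symmDiff a b) = ppar P a + ppar P b := by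
  have hsub : symmDiff a b ⊆ a ∪ b := symmDiff_le_sup
  rw [ppar_eq_par P hsub, ppar_eq_par P (Finset.subset_union_left (s₁ := a) (s₂ := b)),
    ppar_eq_par P (Finset.subset_union_right (s₁ := a) (s₂ := b)), par_symmDiff]

/-- The predicate pairing of an `xorOver` is the sum of the pairings. -/
theorem ppar_xorOver (P : ℕ → Bool) (f : ℕ → Finset ℕ) (rem : List ℕ) :
    ppar P (xorOver f rem) = (rem.map fun g => ppar P (f g)).sum := by
  induction rem with
  | nil => simp [xorOver, ppar]
  | cons g gs ih => rw [xorOver, ppar_symmDiff, ih, List.map_cons, List.sum_cons]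

/-- KERNEL SIDE: the bitmask of a detector list. -/
def lmask : List ℕ → ℕ
  | [] => 0
  | d :: ds => lmask ds ||| (1 <<< d)

/-- The bits of `lmask`. -/
theorem testBit_lmask (l : List ℕ) (j : ℕ) : (lmask l).testBit j = decide (j ∈ l) := by
  induction l with
  | nil => simp [lmask]
  | cons d ds ih =>
    rw [lmask, Nat.testBit_lor, ih, Nat.one_shiftLeft, Nat.testBit_two_pow]
    rcases eq_or_ne j d with rfl | hne
    · simp
    · have hne' : d ≠ j := fun h => hne h.symm
      by_cases h2 : j ∈ ds <;> simp [hne, hne', h2]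

/-- `dedup` does not change the finset of members. -/
private theorem toFinset_dedup' (l : List ℕ) : l.dedup.toFinset = l.toFinset := by
  ext x; simp [List.mem_dedup]

/-! ## Dual tables, masks and their meaning -/

/-- A complete binary tree of naturals (KERNEL SIDE lookup table: detector ↦ its DUAL MASK, bit `i` = `[detector ∈ Y_i]`). -/
inductive BT where
  /-- a leaf value -/
  | lf : ℕ → BT
  /-- an inner node: even keys left, odd keys right -/
  | nd : BT → BT → BT

/-- Lookup by the binary digits of the key, least significant first (`≈ depth` kernel steps; out-of-range keys alias — harmless,
the duals ARE whatever the table returns). -/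
def BT.get : BT → ℕ → ℕ
  | .lf v, _ => v
  | .nd l r, d => if d % 2 = 0 then l.get (d / 2) else r.get (d / 2)

/-- A SEARCH CERTIFICATE: a branching `order` (a permutation of the extended groups `0 … k`) and the DUALS in transposed form —
`dtab` : detector `d` ↦ mask with bit `i` = `[d ∈ Y_i]`; `gms` : extended group `g` ↦ mask with bit `i` = `[g ∈ G_i]`. -/
structure Cert where
  /-- branching order -/
  order : List ℕ
  /-- detector ↦ dual mask -/
  dtab : BT
  /-- extended group ↦ dual mask (a list indexed by group) -/
  gms : List ℕ

/-- SEMANTIC SIDE: dual `i` contains detector `d`. -/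
def Cert.Y (C : Cert) (i d : ℕ) : Bool := (C.dtab.get d).testBit i

/-- SEMANTIC SIDE: dual `i` contains extended group `g`. -/
def Cert.G (C : Cert) (i g : ℕ) : Bool := (C.gms.getD g 0).testBit i

/-- KERNEL SIDE: the detector part of a column's dual mask — XOR of the table entries of its (distinct) detectors. -/
def Cert.cmask (C : Cert) (col : List ℕ) : ℕ := col.dedup.foldr (fun d m => C.dtab.get d ^^^ m) 0

/-- KERNEL SIDE: the DUAL MASK of column `col` of group `g` — bit `i` = `|Y_i ∩ col| + [g ∈ G_i]` (mod 2). -/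
def Cert.dmask (C : Cert) (g : ℕ) (col : List ℕ) : ℕ := C.gms.getD g 0 ^^^ C.cmask col

/-- KERNEL SIDE: the ROOT PAIRING MASK — bit `i` = `|G_i ∩ order|` (mod 2). -/
def Cert.pmask0 (C : Cert) : ℕ := C.order.foldr (fun g m => C.gms.getD g 0 ^^^ m) 0

/-- `bz` of the bits of an xor-fold is the sum. -/
theorem bz_testBit_foldr_xor (h : ℕ → ℕ) (i : ℕ) (l : List ℕ) :
    bz ((l.foldr (fun d m => h d ^^^ m) 0).testBit i) = (l.map fun d => bz ((h d).testBit i)).sum := by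
  induction l with
  | nil => simp [Nat.zero_testBit, bz]
  | cons d ds ih => rw [List.foldr_cons, Nat.testBit_xor, bz_xor, ih, List.map_cons, List.sum_cons]

/-- `cmask` computes the predicate pairings with the column. -/
theorem Cert.bz_testBit_cmask (C : Cert) (i : ℕ) (col : List ℕ) :
    bz ((C.cmask col).testBit i) = ppar (C.Y i) col.toFinset := by
  unfold Cert.cmask
  rw [bz_testBit_foldr_xor, ppar_eq_sum, ← toFinset_dedup' col, List.sum_toFinset _ (List.nodup_dedup col)]
  rfl

/-- SEMANTIC SIDE: `|G_i ∩ rem|` in `ZMod 2`. -/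
def Cert.gpar (C : Cert) (i : ℕ) (rem : List ℕ) : ZMod 2 := (rem.map fun g => bz (C.G i g)).sum

/-- `pmask0` computes `gpar _ order`. -/
theorem Cert.bz_testBit_pmask0 (C : Cert) (i : ℕ) : bz (C.pmask0.testBit i) = C.gpar i C.order := by
  unfold Cert.pmask0 Cert.gpar
  rw [bz_testBit_foldr_xor]
  rfl

/-- SEMANTIC SIDE: the pairing of dual `i` with the state (target `T`, remaining groups `rem`). -/
def Cert.spair (C : Cert) (i : ℕ) (T : Finset ℕ) (rem : List ℕ) : ZMod 2 := ppar (C.Y i) T + C.gpar i rem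

/-- SEMANTIC SIDE: the pairing of dual `i` with column `col` of group `g`. -/
def Cert.mu (C : Cert) (i g : ℕ) (col : List ℕ) : ZMod 2 := ppar (C.Y i) col.toFinset + bz (C.G i g)

/-- `dmask` computes `mu`. -/
theorem Cert.bz_testBit_dmask (C : Cert) (i g : ℕ) (col : List ℕ) : bz ((C.dmask g col).testBit i) = C.mu i g col := by
  unfold Cert.dmask Cert.mu
  rw [Nat.testBit_xor, bz_xor, C.bz_testBit_cmask, add_comm]
  rfl

/-- **FARKAS.** If every column of every remaining group pairs evenly with dual `i`, so does every completion. -/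
theorem Leaf.farkas (L : Leaf) (C : Cert) (i : ℕ) (rem : List ℕ) (T : Finset ℕ) (hC : L.Completes rem T)
    (hval : ∀ g ∈ rem, ∀ col ∈ L.ecolsL g, C.mu i g col = 0) : C.spair i T rem = 0 := by
  obtain ⟨f, hf, rfl⟩ := hC
  unfold Cert.spair Cert.gpar
  rw [ppar_xorOver]
  have heq : (rem.map fun g => ppar (C.Y i) (f g)) = rem.map fun g => bz (C.G i g) := by
    apply List.map_congr_left
    intro g hg
    have hcol : f g ∈ L.ecols g := hf g hg
    rw [Leaf.ecols_eq, List.mem_map] at hcol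
    obtain ⟨col, hcolmem, hcolf⟩ := hcol
    have h0 := hval g hg col hcolmem
    unfold Cert.mu at h0
    rw [hcolf] at h0
    have key : ∀ x y : ZMod 2, x + y = 0 → x = y := by decide
    exact key _ _ h0
  rw [heq]
  have key : ∀ x : ZMod 2, x + x = 0 := by decide
  exact key _

/-! ## The kernel search and its soundness -/

/-- KERNEL SIDE: OR of the dual masks of all columns of the tables. -/
def vmask : List (List (ℕ × ℕ)) → ℕ
  | [] => 0
  | cols :: rest => cols.foldr (fun cm a => cm.2 ||| a) (vmask rest)

/-- A clear bit of an OR-fold is clear in every operand. -/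
theorem testBit_foldr_lor (cols : List (ℕ × ℕ)) (a i : ℕ)
    (h : (cols.foldr (fun cm a => cm.2 ||| a) a).testBit i = false) :
    a.testBit i = false ∧ ∀ cm ∈ cols, cm.2.testBit i = false := by
  induction cols with
  | nil => exact ⟨h, fun _ h' => by simp at h'⟩
  | cons c cs ih =>
    simp only [List.foldr_cons, Nat.testBit_lor, Bool.or_eq_false_iff] at h
    obtain ⟨ha, hcs⟩ := ih h.2
    refine ⟨ha, fun cm hcm => ?_⟩
    rcases List.mem_cons.1 hcm with rfl | h'
    · exact h.1
    · exact hcs cm h'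

/-- A clear bit of `vmask` is clear in every column mask. -/
theorem testBit_vmask : ∀ (tbls : List (List (ℕ × ℕ))) (i : ℕ), (vmask tbls).testBit i = false →
    ∀ cols ∈ tbls, ∀ cm ∈ cols, cm.2.testBit i = false
  | [], _, _ => by simp
  | cols :: rest, i, h => by
    obtain ⟨hrest, hcols⟩ := testBit_foldr_lor cols (vmask rest) i h
    intro cols' hmem
    rcases List.mem_cons.1 hmem with rfl | h'
    · exact hcols
    · exact testBit_vmask rest i hrest cols' h'

/-- If `a ||| b ≠ b` then `a` has a set bit outside `b`. -/
theorem exists_testBit_of_lor_ne {a b : ℕ} (h : a ||| b ≠ b) : ∃ i, a.testBit i = true ∧ b.testBit i = false := by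
  by_contra hc
  apply h
  apply Nat.eq_of_testBit_eq
  intro i
  rw [Nat.testBit_lor]
  cases ha : a.testBit i
  · exact Bool.false_or _
  · cases hb : b.testBit i
    · exact absurd ⟨i, ha, hb⟩ hc
    · rfl

/-- KERNEL SIDE: the column tables along a branching order — per group, per column `(detector mask, dual mask)`. -/
def Leaf.tbl (L : Leaf) (C : Cert) (gs : List ℕ) : List (List (ℕ × ℕ)) :=
  gs.map fun g => (L.ecolsL g).map fun col => (lmask col, C.dmask g col)

/-- KERNEL SIDE: THE SEARCH. State: the tables of the groups still to branch, `p` = pairings of all duals with the current state,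
`t` = target bitmask. A child is pruned when `p` has a bit outside `vmask` of the deeper tables (a VALID dual pairing ODDLY);
at full depth the target must be non-zero. Returns `true` iff every branch is refuted. -/
def dfs : List (List (ℕ × ℕ)) → ℕ → ℕ → Bool
  | [], _, t => !decide (t = 0)
  | cols :: rest, p, t =>
    let V := vmask rest
    cols.all fun cm => !decide ((p ^^^ cm.2) ||| V = V) || dfs rest (p ^^^ cm.2) (t ^^^ cm.1)

/-- **Soundness of the search** (induction along the order): with correct invariants, `dfs = true` refutes every completion. -/
theorem Leaf.dfs_sound (L : Leaf) (C : Cert) :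
    ∀ (gs : List ℕ) (p t : ℕ) (T : Finset ℕ), gs.Nodup → (∀ j, t.testBit j = true ↔ j ∈ T) →
      (∀ i, bz (p.testBit i) = C.spair i T gs) → dfs (L.tbl C gs) p t = true → ¬ L.Completes gs T
  | [], p, t, T, _, ht, _, h => by
    rintro ⟨f, -, hx⟩
    rw [xorOver] at hx
    simp only [Leaf.tbl, List.map_nil, dfs, Bool.not_eq_true', decide_eq_false_iff_not] at h
    apply h
    apply Nat.eq_of_testBit_eq
    intro j
    rw [Nat.zero_testBit]
    cases htj : t.testBit j
    · rfl
    · exact absurd ((ht j).1 htj) (hx ▸ Finset.notMem_empty j)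
  | g :: rest, p, t, T, hnd, ht, hp, h => by
    rintro ⟨f, hf, hx⟩
    have htbl : L.tbl C (g :: rest) = ((L.ecolsL g).map fun col => (lmask col, C.dmask g col)) :: L.tbl C rest := rfl
    rw [htbl] at h
    simp only [dfs, List.all_eq_true, Bool.or_eq_true, Bool.not_eq_true', decide_eq_false_iff_not] at h
    -- the chosen column of `g`
    have hcol : f g ∈ L.ecols g := hf g List.mem_cons_self
    rw [Leaf.ecols_eq, List.mem_map] at hcol
    obtain ⟨col, hcolmem, hcolf⟩ := hcol
    have h := h (lmask col, C.dmask g col) (List.mem_map.2 ⟨col, hcolmem, rfl⟩)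
    -- the completion restricted to `rest`, and the invariants of the child state
    have hxr : xorOver f rest = symmDiff T (f g) := by
      rw [xorOver] at hx
      rw [← hx, symmDiff_comm (f g), symmDiff_assoc, symmDiff_self, symmDiff_bot]
    have hC' : L.Completes rest (symmDiff T (f g)) := ⟨f, fun g' hg' => hf g' (List.mem_cons_of_mem _ hg'), hxr⟩
    have ht' : ∀ j, (t ^^^ lmask col).testBit j = true ↔ j ∈ symmDiff T (f g) := fun j => by
      rw [Nat.testBit_xor, testBit_lmask, Finset.mem_symmDiff, ← hcolf, List.mem_toFinset, ← ht j]
      cases t.testBit j <;> by_cases hj : j ∈ col <;> simp [hj]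
    have hp' : ∀ i, bz ((p ^^^ C.dmask g col).testBit i) = C.spair i (symmDiff T (f g)) rest := fun i => by
      rw [Nat.testBit_xor, bz_xor, hp i, C.bz_testBit_dmask]
      unfold Cert.spair Cert.mu Cert.gpar
      rw [ppar_symmDiff, ← hcolf, List.map_cons, List.sum_cons]
      have key : ∀ a b c x : ZMod 2, a + (x + c) + (b + x) = a + b + c := by decide
      exact key _ _ _ _
    rcases h with hprune | hdeep
    · -- pruned: a currently valid dual pairs oddly with the child state
      obtain ⟨i, hpi, hVi⟩ := exists_testBit_of_lor_ne hprune
      have h1 : C.spair i (symmDiff T (f g)) rest = 1 := by rw [← hp' i, hpi]; rfl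
      have hval := testBit_vmask (L.tbl C rest) i hVi
      have h0 : C.spair i (symmDiff T (f g)) rest = 0 :=
        L.farkas C i rest _ hC' fun g' hg' col' hcol' => by
          have hb : (C.dmask g' col').testBit i = false :=
            hval _ (List.mem_map.2 ⟨g', hg', rfl⟩) _ (List.mem_map.2 ⟨col', hcol', rfl⟩)
          rw [← C.bz_testBit_dmask, hb]; rfl
      rw [h0] at h1
      exact zero_ne_one h1
    · exact L.dfs_sound C rest _ _ _ hnd.of_cons ht' hp' hdeep hC'

/-! ## Certificates and the decider -/

/-- THE DECIDER: the order is a permutation of `0 … k` and the search from the root state refutes everything. -/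
def Leaf.certRefutes (L : Leaf) (C : Cert) : Bool :=
  decide (C.order.Perm (List.range (L.k + 1))) && dfs (L.tbl C C.order) C.pmask0 0

/-- **DECIDER SOUNDNESS.** A leaf with budget `≤ 1` whose certificate passes is NOT realised. -/
theorem Leaf.not_realised_of_certRefutes (L : Leaf) (hb : L.budget ≤ 1) (C : Cert) (h : L.certRefutes C = true) :
    ¬ L.Realised := fun hR => by
  unfold Leaf.certRefutes at h
  rw [Bool.and_eq_true, decide_eq_true_eq] at h
  obtain ⟨hperm, hdfs⟩ := h
  obtain ⟨f, hf, hx⟩ := L.completes_of_realised hb hR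
  have hC : L.Completes C.order ∅ := ⟨f, fun g hg => hf g (hperm.mem_iff.1 hg), by rw [xorOver_perm f hperm, hx]⟩
  refine L.dfs_sound C C.order _ 0 ∅ (hperm.nodup_iff.2 List.nodup_range) (fun j => by simp [Nat.zero_testBit])
    (fun i => ?_) hdfs hC
  rw [C.bz_testBit_pmask0]
  unfold Cert.spair
  simp [ppar]

/-! ## Controls (documentation; tiny leaves decided in the kernel) -/

/-- POSITIVE CONTROL: one group with the single column `{0}`, budget `0` — detector `0` can never be even; one dual `Y = {0}`
(table: even detectors ↦ mask `1`, odd ↦ `0`). -/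
example : (⟨1, [[0]], [[0]], [], [], [], 1⟩ : Leaf).certRefutes ⟨[1, 0], .nd (.lf 1) (.lf 0), []⟩ = true := by decide

/-- NEGATIVE CONTROL: the same group with budget `1` and a null coordinate of column `{0}` IS realisable, and the same certificate
is rejected (the dual is no longer valid below the null group; without pruning the search finds the realisation). -/
example : (⟨2, [[0], [0]], [[0]], [1], [], [], 2⟩ : Leaf).certRefutes ⟨[1, 0], .nd (.lf 1) (.lf 0), []⟩ = false := by decide

/-- BRANCH CONTROL: groups with columns `{0,1} | {1}` and `{0}`, budget `0`: after either choice in group `0` detector `1` is odd and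
no deeper column touches it — dual `Y = {1}` (odd detectors ↦ mask `1`) prunes both children. -/
example : (⟨3, [[0, 1], [1], [0]], [[0, 1], [2]], [], [], [], 2⟩ : Leaf).certRefutes ⟨[2, 0, 1], .nd (.lf 0) (.lf 1), []⟩ = true :=
  by decide

end Fibre

end Summit.Ventures.QEC.CircuitDistance
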